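import Summits.ValiantsHypothesis.ValiantsHypothesis.Theorems.NewtonUnitEquationsTwoProductsRankOneThreeFreeLawSliceExc
import HarnessLib

/-!
# Route NewtonUnitEquations — crux `TwoProducts` (stmt-ValiantsHypothesis-5906), line `relation_ladder`, rung R7a (three-term
# rank one, GENERAL shape `α = qβ + rγ`, `q, r ≥ 1`): the FREE LIFT with DOUBLE SLICING — `RankOneThreeFreeLaw` — part 4/6 — finite SHIFT RANK of the slice functions (T5) and the planar instance (T7)

(T5) shift rank of the additive-form binomials and of the slice functions (`Fsl_shift`, over the landed `R6b.HSD` toolkit); (T7) `RelData` (`α = qβ + rγ`), the free lift `GT`, injectivity from rank-one coincidences, lifted visible points, letter weights, `lwt_split`.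

val-idea-8 g3 (ideator; lens decomp), 2026-08-28. Generalises the R6b module (`α = β + γ`, val-lit-p3 g15's port `…RankOneThreeLaw*`,
imported): the substitution `Y_α ↦ Y_β^q Y_γ^r` has fibres `{x + k(e_α − q e_β − r e_γ)}` of letter count `n_k = R + B_k`, `R = Σ_{rest} x_j`,
`B_k = x_β + x_γ − (q+r−1)k ≥ 0`; slicing BOTH relation coordinates `(b₁, b₂) = (x_β, x_γ)` makes `multinomial(L_k)/n_k = Pfac(x) ·
C(R + B_k − 1, B_k) · κ_k` EXACT with `Pfac = (R−1)!/∏_{rest} x_j!`, so the slice functions are R6b's with `(b − k) ↦ B_k` and no binomial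
character — finite SHIFT RANK, and val-lit-p3's `ShiftRank.pencilCount` applies BY NAME.  Large coefficients (`q > m` or `r > m`) force
permutation type (`msetT a e ≤ m`), handled by R3♯ `permTypeLaw_proof`.

PORT NOTE (val-lit-p3 g15, prover seat, helper mode `--supports stmt-ValiantsHypothesis-5906 --as helper`, no stub credit claimed; the
author's invitation val-width INBOX 11:42Z + desk RULING #279 (c)): part 4/6 of a VERBATIM Theorems-side port of val-idea-8 g3's sorry-free
module `Cruxes/TwoProducts/Lines/relation_ladder_R7a.lean` (tree @0a494ab61a34; sha256 2455bfd4f3ef04f6…; 1 627 lines; `lean check` rc 0,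
0 sorries, 0 warnings). ALL mathematics and ALL proofs are val-idea-8 g3's (engine memo `Lines/relation_ladder_R7_engine.md` rev 2 §7).  The
port changes only: (i) the file split and the import chain; (ii) declarations that the source re-declares VERBATIM from the landed R6b port
(`sum_sgn`, `HSD` + `HSD.mul/mulHom/homMul/constMul/sum/add`, `hsd_binChar`, `rW_pos`) or from the R6 port (`tab`, `sgn`, `rW`,
`toolBound_mono`) or from `…FormalLogLinearisationStubRaysRung` (`wt_nsmul'` = `wt_nsmul`) are NOT re-declared but referenced BY NAME
(`R6b.…` for the sibling namespace); (iii) the section variables are renamed `I ↦ Iq` (the `QIdx` datum) and `D ↦ Dq` (the `RelData`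
datum) — a pure α-renaming forced by the gate's statement-text index (`dedup.landed` keys on declaration text, namespace-blind, and
the R6b port owns same-text lemmas over `ThreeIdx`); (iv) one-line docstrings on API lemmas; (v) in part 6/6 the parameter-free
`def RankOneThreeFreeLaw : Prop` is NOT declared (relocation rule) — the law is stated by its LITERAL body as `rankOneThreeFreeLaw_proof`.
Namespace = the author's (`…PermutationType.R7a`).  Nothing here closes the line's residual, the crux `TwoProducts` (5906) or `VP ≠ VNP`;
no summit statement is proved.

Honest scope (the author's): relations with the lone letter carrying a coefficient `p ≥ 2` (e.g. `2β = α + γ` = R6c, `pβ = qα + rγ`), two-letter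
`pα = qβ`, support ≥ 4 and coincidence rank ≥ 2 are NOT covered here.  Nothing here moves VP ≠ VNP; `TwoProducts` (5906) stays OPEN. [folklore]
-/

noncomputable section

-- Sub = Summit single-conjunct layout: the duplicated namespace component is mandated by the tree.
set_option linter.dupNamespace false
set_option linter.unusedSimpArgs false
set_option linter.deprecated false
set_option linter.unusedSectionVars false
set_option linter.unusedVariables false
set_option linter.unnecessarySeqFocus false

namespace Summit.ValiantsHypothesis.ValiantsHypothesis.Theorems.NewtonUnitEquations.TwoProducts.PermutationType
namespace R7a
open scoped BigOperators
open MvPolynomial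

variable {σ : Type*} [Fintype σ] [DecidableEq σ]

variable (Iq : QIdx σ)

/-! ## Part T5: finite SHIFT RANK of the slice functions — the hypothesis of val-lit-p3's `ShiftRank.pencilCount` -/

section ShiftDecomp

/-- `lam_add` — technical lemma of the R7a free-lift toolkit (val-idea-8 g3). [folklore] -/
theorem lam_add (β w : σ → ℕ) : lam Iq (β + w) = lam Iq β + lam Iq w := by
  unfold lam
  simp only [Pi.add_apply, Finset.sum_add_distrib]

/-- Binomial coefficients of the additive form `λ` have shift rank `d + 1` (Vandermonde). [folklore] -/
theorem hsd_choose (e d b₀ : ℕ) (hd : d ≤ b₀) :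
    R6b.HSD (Fin (b₀ + 1)) (fun ν : σ → ℕ => (((lam Iq ν + e).choose d : ℕ) : ℂ)) := by
  refine ⟨fun β p => if (p : ℕ) ≤ d then (((lam Iq β + e).choose p : ℕ) : ℂ) else 0,
    fun p w => (((lam Iq w).choose (d - p) : ℕ) : ℂ), fun β w => ?_⟩
  have hnat : (lam Iq β + e + lam Iq w).choose d =
      ∑ p ∈ Finset.range (d + 1), (lam Iq β + e).choose p * (lam Iq w).choose (d - p) := by
    have h := Finset.Nat.sum_antidiagonal_eq_sum_range_succ
      (fun p q => (lam Iq β + e).choose p * (lam Iq w).choose q) d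
    rw [Nat.succ_eq_add_one] at h
    rw [← h, Nat.add_choose_eq]
  simp only
  rw [lam_add, show lam Iq β + lam Iq w + e = lam Iq β + e + lam Iq w by ring, hnat]
  push_cast
  rw [Fin.sum_univ_eq_sum_range (fun p => (if p ≤ d then (((lam Iq β + e).choose p : ℕ) : ℂ) else 0) *
      (((lam Iq w).choose (d - p) : ℕ) : ℂ)) (b₀ + 1)]
  simp_rw [ite_mul, zero_mul]
  rw [← Finset.sum_filter]
  congr 1
  ext p
  simp only [Finset.mem_range, Finset.mem_filter]
  omega

/-- `restProd_add` — technical lemma of the R7a free-lift toolkit (val-idea-8 g3). [folklore] -/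
theorem restProd_add (t : σ → ℂ) (β w : σ → ℕ) : restProd Iq t (β + w) = restProd Iq t β * restProd Iq t w := by
  unfold restProd
  rw [← Finset.prod_mul_distrib]
  exact Finset.prod_congr rfl fun j _ => by rw [Pi.add_apply, pow_add]

/-- `ind_add` — technical lemma of the R7a free-lift toolkit (val-idea-8 g3). [folklore] -/
theorem ind_add (β w : σ → ℕ) : ind Iq (β + w) = ind Iq β * ind Iq w := by
  unfold ind
  simp only [Pi.add_apply]
  by_cases hβ : β Iq.a = 0 ∧ β Iq.b = 0 ∧ β Iq.c = 0 <;> by_cases hw : w Iq.a = 0 ∧ w Iq.b = 0 ∧ w Iq.c = 0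
  · rw [if_pos hβ, if_pos hw, if_pos ⟨by omega, by omega, by omega⟩, mul_one]
  · rw [if_pos hβ, if_neg hw, if_neg (fun h => hw ⟨by omega, by omega, by omega⟩), mul_zero]
  · rw [if_neg hβ, if_neg (fun h => hβ ⟨by omega, by omega, by omega⟩), zero_mul]
  · rw [if_neg hβ, if_neg (fun h => hβ ⟨by omega, by omega, by omega⟩), zero_mul]

variable {m : ℕ}

/-- `corr_hsd` — technical lemma of the R7a free-lift toolkit (val-idea-8 g3). [folklore] -/
theorem corr_hsd (c d : Fin m → σ → ℂ) (b₁ b₂ : ℕ) : R6b.HSD Unit (corr Iq c d b₁ b₂) := by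
  refine ⟨fun β _ => corr Iq c d b₁ b₂ β, fun _ w => if (∀ j, w j = 0) then 1 else 0, fun β w => ?_⟩
  rw [Fintype.sum_unique]
  dsimp only
  unfold corr
  by_cases hβ : ∀ j, β j = 0
  · by_cases hw : ∀ j, w j = 0
    · rw [if_pos hw, if_pos hβ, mul_one, if_pos]
      intro j; rw [Pi.add_apply, hβ j, hw j]
    · rw [if_neg hw, mul_zero, if_neg]
      intro h; apply hw; intro j; have := h j; rw [Pi.add_apply] at this; omega
  · rw [if_neg hβ, zero_mul, if_neg]
    intro h; apply hβ; intro j; have := h j; rw [Pi.add_apply] at this; omega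

/-- Each `(j, k)` term has shift rank `≤ b₁ + b₂ + 1`. [folklore] -/
theorem mainTerm_hsd (c d : Fin m → σ → ℂ) (b₁ b₂ : ℕ) (j : Fin m ⊕ Fin m) (k : ℕ) :
    R6b.HSD (Fin (b₁ + b₂ + 1)) (mainTerm Iq c d b₁ b₂ j k) := by
  by_cases hk : Iq.q * k ≤ b₁ ∧ Iq.r * k ≤ b₂
  · have h1 := hsd_choose Iq (Bk Iq b₁ b₂ k - 1) (Bk Iq b₁ b₂ k) (b₁ + b₂) (Bk_le Iq hk)
    have h2 := R6b.HSD.homMul (restProd_add Iq (tab c d j)) h1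
    have h3 := h2.constMul (mainConst Iq c d b₁ b₂ j k)
    unfold mainTerm
    exact h3
  · refine ⟨fun _ _ => 0, fun _ _ => 0, fun β w => ?_⟩
    unfold mainTerm
    rw [mainConst_eq_zero Iq c d hk j, zero_mul]
    simp

/-- The slice index set (`|SIdx m b₁ b₂| = 2 m (b₁ + b₂ + 1)^2 + 1`). [folklore] -/
abbrev SIdx (m b₁ b₂ : ℕ) := ((Fin m ⊕ Fin m) × (Fin (b₁ + b₂ + 1) × Fin (b₁ + b₂ + 1))) ⊕ Unit

/-- `card_SIdx` — technical lemma of the R7a free-lift toolkit (val-idea-8 g3). [folklore] -/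
theorem card_SIdx (m b₁ b₂ : ℕ) : Fintype.card (SIdx m b₁ b₂) = 2 * m * (b₁ + b₂ + 1) ^ 2 + 1 := by
  simp only [SIdx, Fintype.card_sum, Fintype.card_prod, Fintype.card_fin, Fintype.card_unit]
  ring

/-- **Finite shift rank of the slice functions.** [folklore] -/
theorem Fsl_hsd (c d : Fin m → σ → ℂ) (b₁ b₂ : ℕ) : R6b.HSD (SIdx m b₁ b₂) (Fsl Iq c d b₁ b₂) := by
  have hmain : R6b.HSD ((Fin m ⊕ Fin m) × (Fin (b₁ + b₂ + 1) × Fin (b₁ + b₂ + 1)))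
      (fun ν => ∑ j : Fin m ⊕ Fin m, ∑ k : Fin (b₁ + b₂ + 1), mainTerm Iq c d b₁ b₂ j k ν) :=
    R6b.HSD.sum _ fun j => R6b.HSD.sum (fun (k : Fin (b₁ + b₂ + 1)) ν => mainTerm Iq c d b₁ b₂ j k ν)
      fun k => mainTerm_hsd Iq c d b₁ b₂ j k
  have h := (R6b.HSD.homMul (ind_add Iq) hmain).add (corr_hsd Iq c d b₁ b₂)
  unfold Fsl
  exact h

/-- The shift decomposition, unpacked. [folklore] -/
theorem Fsl_shift (c d : Fin m → σ → ℂ) (b₁ b₂ : ℕ) :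
    ∃ (col : (σ → ℕ) → SIdx m b₁ b₂ → ℂ) (ch : SIdx m b₁ b₂ → (σ → ℕ) → ℂ),
      ∀ β w : σ → ℕ, Fsl Iq c d b₁ b₂ (β + w) = ∑ i, col β i * ch i w :=
  Fsl_hsd Iq c d b₁ b₂

end ShiftDecomp

/-! ## Part T7: the planar instance — relation data `α = qβ + rγ`, the free lift of the chain, injectivity of the letter
push-forward on the lifted support from rank-one coincidences, lifted visible points, letter weights -/

section FreePlanar
open Summit.ValiantsHypothesis.ValiantsHypothesis.Theorems.NewtonUnitEquations.TwoProducts.FormalLogLinearisation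
open Summit.ValiantsHypothesis.ValiantsHypothesis.Theorems.NewtonUnitEquations.TwoProducts.PlanarCell

variable {m : ℕ}
variable (u v : Fin m → MvPolynomial (Fin 2) ℂ)

/-- **Planar three-term relation data with coefficients**: distinct tail letters `α, β, γ` with `α = q β + r γ`, `q, r ≥ 1`.
[folklore] -/
structure RelData where
  /-- the letter `α` -/
  α : Expo
  /-- the letter `β` -/
  β : Expo
  /-- the letter `γ` -/
  γ : Expo
  /-- the coefficient of `β` -/
  q : ℕ
  /-- the coefficient of `γ` -/
  r : ℕ
  hq : 1 ≤ q
  hr : 1 ≤ r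
  hα : α ∈ tailSupport u v
  hβ : β ∈ tailSupport u v
  hγ : γ ∈ tailSupport u v
  hab : α ≠ β
  hac : α ≠ γ
  hbc : β ≠ γ
  hrel : α = q • β + r • γ

variable {u v}
variable (Dq : RelData u v)

/-- The indices and coefficients of the relation letters. [folklore] -/
def RelData.idx : QIdx (Fin (sE u v)) where
  a := idxOf u v Dq.α Dq.hα
  b := idxOf u v Dq.β Dq.hβ
  c := idxOf u v Dq.γ Dq.hγ
  q := Dq.q
  r := Dq.r
  hq := Dq.hq
  hr := Dq.hr
  hab h := Dq.hab (by have := congrArg (enum u v) h; rwa [enum_idxOf, enum_idxOf] at this)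
  hac h := Dq.hac (by have := congrArg (enum u v) h; rwa [enum_idxOf, enum_idxOf] at this)
  hbc h := Dq.hbc (by have := congrArg (enum u v) h; rwa [enum_idxOf, enum_idxOf] at this)

/-- `RelData.enum_a` — technical lemma of the R7a free-lift toolkit (val-idea-8 g3). [folklore] -/
theorem RelData.enum_a : enum u v Dq.idx.a = Dq.α := enum_idxOf u v _ _
/-- `RelData.enum_b` — technical lemma of the R7a free-lift toolkit (val-idea-8 g3). [folklore] -/
theorem RelData.enum_b : enum u v Dq.idx.b = Dq.β := enum_idxOf u v _ _
/-- `RelData.enum_c` — technical lemma of the R7a free-lift toolkit (val-idea-8 g3). [folklore] -/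
theorem RelData.enum_c : enum u v Dq.idx.c = Dq.γ := enum_idxOf u v _ _
/-- `RelData.idx_q` — technical lemma of the R7a free-lift toolkit (val-idea-8 g3). [folklore] -/
theorem RelData.idx_q : Dq.idx.q = Dq.q := rfl
/-- `RelData.idx_r` — technical lemma of the R7a free-lift toolkit (val-idea-8 g3). [folklore] -/
theorem RelData.idx_r : Dq.idx.r = Dq.r := rfl

/-- The letter push-forward is invariant under the free substitution: `π_enum (frM i) = enum i`. [folklore] -/
theorem RelData.piE_enum_frM (i : Fin (sE u v)) : piE (enum u v) (frM Dq.idx i) = enum u v i := by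
  by_cases hia : i = Dq.idx.a
  · subst hia
    rw [frM_a, piE_eq_piT, piT_add, piT_single, piT_single, Dq.enum_b, Dq.enum_c, Dq.enum_a, Dq.hrel, Dq.idx_q, Dq.idx_r]
  · rw [frM_other Dq.idx i hia, piE_eq_piT, piT_single, one_smul]

/-- On exponents: letter push-forward ∘ free substitution = letter push-forward. [folklore] -/
theorem RelData.piE_enum_piT (L : Fin (sE u v) →₀ ℕ) : piE (enum u v) (piT (frM Dq.idx) L) = piE (enum u v) L := by
  have hM : (fun i => piT (enum u v) (frM Dq.idx i)) = enum u v := by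
    funext i
    rw [← piE_eq_piT]
    exact Dq.piE_enum_frM i
  rw [piE_eq_piT, piE_eq_piT, piT_piT, hM]

/-- On polynomials: letter push-forward ∘ free substitution = letter push-forward. [folklore] -/
theorem RelData.phi_enum_phiT (H : MvPolynomial (Fin (sE u v)) ℂ) :
    phi (enum u v) (phiT (frM Dq.idx) H) = phi (enum u v) H := by
  have hM : (fun i => piT (enum u v) (frM Dq.idx i)) = enum u v := by
    funext i
    rw [← piE_eq_piT]
    exact Dq.piE_enum_frM i
  rw [phi_eq_phiT, phiT_phiT, hM]

/-- The free lift of the chain difference. [folklore] -/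
def RelData.GT : MvPolynomial (Fin (sE u v)) ℂ := phiT (frM Dq.idx) (liftG (cU u v) (cV u v))

/-- Its letter push-forward is the planar difference of products. [folklore] -/
theorem RelData.phi_GT : phi (enum u v) Dq.GT = tailDiff u v := by
  unfold RelData.GT
  rw [Dq.phi_enum_phiT, phi_liftG]

/-- `RelData.exists_of_mem_support_GT` — technical lemma of the R7a free-lift toolkit (val-idea-8 g3). [folklore] -/
theorem RelData.exists_of_mem_support_GT (x : Fin (sE u v) →₀ ℕ) (hx : x ∈ Dq.GT.support) :
    ∃ L ∈ (liftG (cU u v) (cV u v)).support, piT (frM Dq.idx) L = x :=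
  exists_of_mem_support_phiT (frM Dq.idx) _ x hx

/-- `RelData.apply_a_of_mem_support_GT` — technical lemma of the R7a free-lift toolkit (val-idea-8 g3). [folklore] -/
theorem RelData.apply_a_of_mem_support_GT (x : Fin (sE u v) →₀ ℕ) (hx : x ∈ Dq.GT.support) : x Dq.idx.a = 0 := by
  obtain ⟨L, -, rfl⟩ := Dq.exists_of_mem_support_GT x hx
  exact piT_frM_a Dq.idx L

/-- **Injectivity from rank-one coincidences** (shape `α = qβ + rγ`). [folklore] -/
theorem RelData.injOn_of_rankOne (hu : ∀ j, coeff 0 (u j) = 0) (hv : ∀ j, coeff 0 (v j) = 0)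
    (hR : RankOneCoincidences (fun j => (u j).support ∪ (v j).support)
      (Finsupp.single Dq.β Dq.q + Finsupp.single Dq.γ Dq.r) (Finsupp.single Dq.α 1)) :
    Set.InjOn (piE (enum u v)) ↑Dq.GT.support := by
  classical
  set A : Fin m → Finset Expo := fun j => (u j).support ∪ (v j).support with hA
  have hcU : ∀ j i, cU u v j i ≠ 0 → enum u v i ∈ A j := fun j i h =>
    Finset.mem_union_left _ (mem_support_iff.mpr h)
  have hcV : ∀ j i, cV u v j i ≠ 0 → enum u v i ∈ A j := fun j i h =>
    Finset.mem_union_right _ (mem_support_iff.mpr h)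
  have key : ∀ κ ∈ (liftG (cU u v) (cV u v)).support,
      ∃ a ∈ tuples A, ∑ j, a j = piE (enum u v) κ ∧ msetT a = Finsupp.mapDomain (enum u v) κ := by
    intro κ hκ
    unfold liftG at hκ
    rcases Finset.mem_union.1 (support_sub _ _ _ hκ) with h | h
    · exact tuple_of_mem_support_prod u v hu hv A (cU u v) hcU κ h
    · exact tuple_of_mem_support_prod u v hu hv A (cV u v) hcV κ h
  set ρp : Fin (sE u v) →₀ ℕ := Finsupp.single Dq.idx.b Dq.q + Finsupp.single Dq.idx.c Dq.r with hρp
  set ρm : Fin (sE u v) →₀ ℕ := Finsupp.single Dq.idx.a 1 with hρm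
  have hmp : Finsupp.mapDomain (enum u v) ρp = Finsupp.single Dq.β Dq.q + Finsupp.single Dq.γ Dq.r := by
    rw [hρp, Finsupp.mapDomain_add, Finsupp.mapDomain_single, Finsupp.mapDomain_single, Dq.enum_b, Dq.enum_c]
  have hmm : Finsupp.mapDomain (enum u v) ρm = Finsupp.single Dq.α 1 := by
    rw [hρm, Finsupp.mapDomain_single, Dq.enum_a]
  have hπρ : piT (frM Dq.idx) ρp = piT (frM Dq.idx) ρm := by
    rw [hρp, hρm, piT_add, piT_single, piT_single, piT_single, one_smul,
      frM_other Dq.idx Dq.idx.b Dq.idx.hab.symm, frM_other Dq.idx Dq.idx.c Dq.idx.hac.symm, frM_a,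
      Finsupp.smul_single_one, Finsupp.smul_single_one, Dq.idx_q, Dq.idx_r]
  have hmapk : ∀ (k : ℕ) (L ρ : Fin (sE u v) →₀ ℕ),
      Finsupp.mapDomain (enum u v) (L + k • ρ) = Finsupp.mapDomain (enum u v) L + k • Finsupp.mapDomain (enum u v) ρ := by
    intro k L ρ
    rw [Finsupp.mapDomain_add]
    congr 1
    exact map_nsmul (Finsupp.mapDomain.addMonoidHom (enum u v)) k ρ
  have cancel : ∀ (k : ℕ) (L L' : Fin (sE u v) →₀ ℕ), L + k • ρp = L' + k • ρm →
      piT (frM Dq.idx) L = piT (frM Dq.idx) L' := by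
    intro k L L' h
    have := congrArg (piT (frM Dq.idx)) h
    rw [piT_add, piT_add, piT_nsmul, piT_nsmul, hπρ] at this
    exact add_right_cancel this
  intro x hx x' hx' hπ
  obtain ⟨L, hL, rfl⟩ := Dq.exists_of_mem_support_GT x hx
  obtain ⟨L', hL', rfl⟩ := Dq.exists_of_mem_support_GT x' hx'
  rw [Dq.piE_enum_piT, Dq.piE_enum_piT] at hπ
  obtain ⟨a, ha, haS, haM⟩ := key L hL
  obtain ⟨b, hb, hbS, hbM⟩ := key L' hL'
  obtain ⟨k, hk⟩ := hR a ha b hb (by rw [haS, hbS]; exact hπ)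
  rw [haM, hbM, ← hmp, ← hmm, ← hmapk, ← hmapk, ← hmapk, ← hmapk] at hk
  rcases hk with hk | hk
  · exact cancel k L L' (Finsupp.mapDomain_injective (enum_injective u v) hk)
  · exact (cancel k L' L (Finsupp.mapDomain_injective (enum_injective u v) hk)).symm

/-- Visible points lift to strict `ξ`-maxima of the freely lifted support (under injectivity). [folklore] -/
theorem RelData.lifted_of_visible (hinj : Set.InjOn (piE (enum u v)) ↑Dq.GT.support) (ξ : Fin 2 → ℝ) (l : Expo)
    (htop : IsStrictTop ξ ↑(tailDiff u v).support l) :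
    ∃ x₀ : Fin (sE u v) →₀ ℕ, x₀ ∈ Dq.GT.support ∧ piE (enum u v) x₀ = l ∧
      ∀ x ∈ Dq.GT.support, x ≠ x₀ → wt ξ (piE (enum u v) x) < wt ξ l := by
  have hsupp : tailDiff u v = phi (enum u v) Dq.GT := Dq.phi_GT.symm
  obtain ⟨hl, hlt⟩ := htop
  have hl' : l ∈ (phi (enum u v) Dq.GT).support := by rw [← hsupp]; exact hl
  obtain ⟨x₀, hx₀, hπ⟩ := exists_of_mem_support_phi (enum u v) _ l hl'
  refine ⟨x₀, hx₀, hπ, fun x hx hne => ?_⟩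
  have hcoeff : coeff (piE (enum u v) x) (tailDiff u v) ≠ 0 := by
    rw [hsupp, coeff_phi_of_injOn (enum u v) _ hinj x hx]
    exact mem_support_iff.mp hx
  have hneπ : piE (enum u v) x ≠ l := fun h => hne (hinj hx hx₀ (h.trans hπ.symm))
  exact hlt _ (mem_support_iff.mpr hcoeff) hneπ

/-! ### The upstairs weights: the letter weights themselves -/


/-- Linear weights of a multiple of a single letter. [folklore] -/
theorem lwt_single_n {τ : Type*} [Fintype τ] [DecidableEq τ] (θ : τ → ℝ) (i : τ) (n : ℕ) :
    lwt θ (Finsupp.single i n) = (n : ℝ) * θ i := by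
  classical
  unfold lwt
  rw [Finset.sum_eq_single i (fun j _ hj => by rw [Finsupp.single_apply, if_neg (Ne.symm hj)]; simp)
    (fun h => absurd (Finset.mem_univ i) h)]
  rw [Finsupp.single_eq_same]; ring


/-- The relation among letter weights: `r_a = q r_b + r r_c`. [folklore] -/
theorem RelData.rW_rel (ξ : Fin 2 → ℝ) :
    rW ξ Dq.idx.a = (Dq.q : ℝ) * rW ξ Dq.idx.b + (Dq.r : ℝ) * rW (u := u) (v := v) ξ Dq.idx.c := by
  unfold rW
  rw [Dq.enum_a, Dq.enum_b, Dq.enum_c, Dq.hrel, wt_add, wt_nsmul, wt_nsmul]; ring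

/-- The letter weight of a substituted letter is its planar weight. [folklore] -/
theorem RelData.lwt_rW_frM (ξ : Fin 2 → ℝ) (i : Fin (sE u v)) : lwt (rW ξ) (frM Dq.idx i) = rW (u := u) (v := v) ξ i := by
  by_cases hia : i = Dq.idx.a
  · subst hia; rw [frM_a, lwt_add, lwt_single_n, lwt_single_n, Dq.rW_rel, Dq.idx_q, Dq.idx_r]
  · rw [frM_other Dq.idx i hia, lwt_single_n]; simp

/-- On toric images the letter weight is the planar weight of the push-forward. [folklore] -/
theorem RelData.lwt_rW_piT (ξ : Fin 2 → ℝ) (L : Fin (sE u v) →₀ ℕ) :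
    lwt (rW ξ) (piT (frM Dq.idx) L) = -wt ξ (piE (enum u v) (piT (frM Dq.idx) L)) := by
  rw [lwt_piT, Dq.piE_enum_piT, ← lwt_eq_neg_wt]
  congr 1
  funext i
  exact Dq.lwt_rW_frM ξ i

/-- Splitting a linear weight along the slices: `θ(x) = Σ_i θ_i x̂_i + θ_b x_b + θ_c x_c` for `x_a = 0`. [folklore] -/
theorem lwt_split (Iq : QIdx σ) (θ : σ → ℝ) (x : σ →₀ ℕ) (hx : x Iq.a = 0) :
    lwt θ x = (∑ i, θ i * ((xhat Iq x i : ℕ) : ℝ)) + θ Iq.b * ((x Iq.b : ℕ) : ℝ) + θ Iq.c * ((x Iq.c : ℕ) : ℝ) := by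
  unfold lwt
  rw [sum_three_split Iq, sum_three_split Iq (fun i => θ i * ((xhat Iq x i : ℕ) : ℝ)), xhat_a, xhat_b, xhat_c, hx]
  have hr : ∑ i ∈ rest Iq, θ i * ((x i : ℕ) : ℝ) = ∑ i ∈ rest Iq, θ i * ((xhat Iq x i : ℕ) : ℝ) := by
    refine Finset.sum_congr rfl fun j hj => ?_
    rw [xhat_rest Iq x j hj]
  rw [hr]
  push_cast
  ring

end FreePlanar

end R7a
end Summit.ValiantsHypothesis.ValiantsHypothesis.Theorems.NewtonUnitEquations.TwoProducts.PermutationType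

end
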